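import Summits.CriticalPhenomena.PercolationContinuityZ3.Theorems.PercNearOneGluingNoHeavyPcintNawMemZ5M10Defs
import HarnessLib

/-!
# PCINT lane, kernel reduced-state B2r certificate `Z5M10` (d = 5, memory τ = 10, 798 state classes): row checks 2 (rows [400, 798))

Cell `prim-pcint`, seat `prim-pcint-1` (gen 5); memo `run/shared/lean/prim/pcint/INTERVAL-PLAN.md` §16 ("checker for the reduced-state
automata").  Does NOT build on p205010.  Data for `NawK.le_siteCriticalProb_of_checkRows` (`…PcintNawRandMemKernelCert`): `p = 12600/100000`,
`q̄ = 98515/100000` (`q̄^9·100000^9 ≥ (100000-12600)·100000^8`), `κ̄ = (100000+98515)/(2·100000)`, `λ = 99999/100000`; Collatz–Wielandt weights (scale 10⁹) from a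
power iteration, exact off-line max row ratio 0.9995005449 < λ.  Generated by gen5/gen_lean.py (pcint-1 folder); the kernel re-checks every row.
-/

namespace Summit.CriticalPhenomena.PercolationContinuityZ3.Theorems.Pcint.NawMemZ5M10

set_option maxHeartbeats 0 in
/-- Rows `[400, 500)` pass the check. [folklore] -/
theorem chk_400 : WinK.allRange (NawK.checkRow 10 5 798 12600 98515 100000 99999 100000 NawMemZ5M10.syms NawMemZ5M10.tree) 400 500 = true :=
  WinK.allRange_of_allRangeB (fuel := 8) (lo := 400) (len := 100) (by decide +kernel)

set_option maxHeartbeats 0 in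
/-- Rows `[500, 600)` pass the check. [folklore] -/
theorem chk_500 : WinK.allRange (NawK.checkRow 10 5 798 12600 98515 100000 99999 100000 NawMemZ5M10.syms NawMemZ5M10.tree) 500 600 = true :=
  WinK.allRange_of_allRangeB (fuel := 8) (lo := 500) (len := 100) (by decide +kernel)

set_option maxHeartbeats 0 in
/-- Rows `[600, 700)` pass the check. [folklore] -/
theorem chk_600 : WinK.allRange (NawK.checkRow 10 5 798 12600 98515 100000 99999 100000 NawMemZ5M10.syms NawMemZ5M10.tree) 600 700 = true :=
  WinK.allRange_of_allRangeB (fuel := 8) (lo := 600) (len := 100) (by decide +kernel)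

set_option maxHeartbeats 0 in
/-- Rows `[700, 798)` pass the check. [folklore] -/
theorem chk_700 : WinK.allRange (NawK.checkRow 10 5 798 12600 98515 100000 99999 100000 NawMemZ5M10.syms NawMemZ5M10.tree) 700 798 = true :=
  WinK.allRange_of_allRangeB (fuel := 8) (lo := 700) (len := 98) (by decide +kernel)

/-- Rows `[400, 798)` pass the check. [folklore] -/
theorem file_2 : WinK.allRange (NawK.checkRow 10 5 798 12600 98515 100000 99999 100000 NawMemZ5M10.syms NawMemZ5M10.tree) 400 798 = true := (WinK.allRange_split (WinK.allRange_split (WinK.allRange_split chk_400 chk_500) chk_600) chk_700)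

end Summit.CriticalPhenomena.PercolationContinuityZ3.Theorems.Pcint.NawMemZ5M10
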